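import Summits.KontsevichZagierPeriods.KontsevichZagierPeriods.Theorems.GammaHodgeSector.Negative.Algebraicity
import Summits.KontsevichZagierPeriods.KontsevichZagierPeriods.Theorems.GammaHodgeSector.Negative.Calibration
import Literature.NumberTheory.Transcendental.KZProductIdeal
import Literature.NumberTheory.Transcendental.KZMellinFibres
import Literature.NumberTheory.Transcendental.KZSemialgebraicComplex
import Literature.NumberTheory.Transcendental.KZLogCalculusProofs
import Mathlib.MeasureTheory.Measure.Lebesgue.VolumeOfBalls
import Mathlib.MeasureTheory.Integral.Pi

/-!
# `GammaHodgeSector` (stmt-KontsevichZagierPeriods-3742) — canonical representations, value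
formulas, the exact non-vacuity criterion and the canonical form of the crux

Landed copy of §11 of the crux work file `Cruxes/GammaHodgeSector/Disproof.lean` (standing
adversary `cdisprove`, gen 2; adapted by the line lead, seat c1 — the section was announced as
`Negative/Canonical.lean` but never proposed). Contents:

* `ballRep k C = [B^{2k}, C]` with `value = C · π^k / k!` (`volume_unitBall_even`);
* `cubeRep x y = [(0,1)^N, Π_j t_j^{x_j−1}(1−t_j)^{y_j−1}]` with `value = Π_j B(x_j, y_j)`
  (`cubeRep_value`, Fubini over the product set);
* `ballCubeRep k x' y' c = [B^{2k}, c·k!] × cubeRep x' y'` with `value = c · π^k · Π_l B(x'_l, y'_l)`;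
* every representation PINNED as in the crux (`IsCubeBetaRep`, `IsBallCubeRep`) is congruent to
  the canonical one (`equivalent_cubeRep_of_isCubeBetaRep`, `equivalent_ballCubeRep_of_isBallCubeRep`),
  hence the value formulas `value_of_isCubeBetaRep`, `value_of_isBallCubeRep`;
* `exists_pinned_valueEq_iff`: pinned `r, r'` WITH EQUAL VALUES exist iff `c` is algebraic and the
  Deligne identity `Π B(x,y) = c · π^k · Π B(x',y')` holds (`DeligneIdentity`);
* `gammaHodgeSector_iff_canonical`: the crux ⟺ for all admissible Hodge-type data and every
  algebraic `c` with the Deligne identity, `cubeRep x y ∼ ballCubeRep k x' y' c`.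

Used by the instance certificates of the crux (e.g. `…GammaHodgeSectorFermat33`).
-/

noncomputable section

open MeasureTheory Set
open scoped BigOperators

namespace Summit.KontsevichZagierPeriods.GammaHodgeSectorNegative

open Literature.NumberTheory.Transcendental
open Literature.NumberTheory.Transcendental.KZ
open Literature.ModelTheory.ExponentialFields (IsSemialgebraic isSemialgebraic_univ
  isSemialgebraic_setOf_eval_pos)
open Summit.KontsevichZagierPeriods.KontsevichZagierPeriods.Theses.TerasomaMultiplication (GammaHodgeSector)

/-! ## The unit `2k`-ball representation `[B^{2k}, C]` and its value `C · π^k / k!` -/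

/-- The open unit ball `{Σ w_i² < 1} ⊆ ℝⁿ` (Euclidean, in the product coordinates). [folklore] -/
def unitBall (n : ℕ) : Set (Fin n → ℝ) := {w | ∑ i, w i ^ 2 < 1}

/-- The unit ball is `ℚ`-semialgebraic (`0 < 1 − Σ X_i²`). [folklore] -/
theorem isSemialgebraic_unitBall (n : ℕ) : IsSemialgebraic ℚ (unitBall n) := by
  have h := isSemialgebraic_setOf_eval_pos (k := ℚ) (R := ℝ)
    (1 - ∑ i : Fin n, MvPolynomial.X i ^ 2 : MvPolynomial (Fin n) ℚ)
  convert h using 1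
  ext w
  simp only [unitBall, mem_setOf_eq, map_sub, map_one, map_sum, map_pow, MvPolynomial.aeval_X, sub_pos]

/-- The unit ball is measurable. [folklore] -/
theorem measurableSet_unitBall (n : ℕ) : MeasurableSet (unitBall n) :=
  (isOpen_lt (by fun_prop) continuous_const).measurableSet

/-- **Volume of the unit `2k`-ball** in `ℝ^{2k}`: `π^k / k!` (Mathlib's
`InnerProductSpace.volume_ball_of_dim_even`, transported along `WithLp.ofLp`). [folklore] -/
theorem volume_unitBall_even (k : ℕ) :
    volume (unitBall (2 * k)) = ENNReal.ofReal (Real.pi ^ k / (k.factorial : ℝ)) := by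
  rcases Nat.eq_zero_or_pos k with rfl | hk
  · -- `ℝ⁰`: the ball is the whole one-point space
    change volume (unitBall 0) = _
    have : unitBall 0 = univ := by
      ext w; simp [unitBall]
    rw [this, volume_pi, Measure.pi_of_empty _ (fun i => i.elim0)]
    simp
  · have hpre : (WithLp.ofLp : EuclideanSpace ℝ (Fin (2 * k)) → (Fin (2 * k) → ℝ)) ⁻¹' unitBall (2 * k) =
        Metric.ball (0 : EuclideanSpace ℝ (Fin (2 * k))) 1 := by
      rw [EuclideanSpace.ball_zero_eq 1 zero_le_one, one_pow]
      ext x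
      simp [unitBall]
    have hnt : Nontrivial (EuclideanSpace ℝ (Fin (2 * k))) := by
      have : Nonempty (Fin (2 * k)) := ⟨⟨0, by omega⟩⟩
      infer_instance
    rw [← (PiLp.volume_preserving_ofLp (Fin (2 * k))).measure_preimage
      (measurableSet_unitBall _).nullMeasurableSet, hpre,
      InnerProductSpace.volume_ball_of_dim_even (k := k) (by simp) (0 : EuclideanSpace ℝ (Fin (2 * k))) 1]
    simp

/-- The unit-ball representation `[B^{2k}, C]` with an algebraic constant `C`. [folklore] -/
def ballRep (k : ℕ) (C : ℝ) (hC : IsAlgebraic ℚ C) : IntegralRep (2 * k) where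
  domain := unitBall (2 * k)
  integrand := fun _ => C
  isSemialgebraic_domain := isSemialgebraic_unitBall _
  isSemialgebraicFunOn_integrand := isSemialgebraicFunOn_const_of_isAlgebraic (isSemialgebraic_unitBall _) hC
  integrableOn := integrableOn_const (by simp [volume_unitBall_even])

/-- `value [B^{2k}, C] = C · π^k / k!`. [folklore] -/
theorem ballRep_value (k : ℕ) (C : ℝ) (hC : IsAlgebraic ℚ C) :
    (ballRep k C hC).value = C * (Real.pi ^ k / (k.factorial : ℝ)) := by
  rw [IntegralRep.value, show (ballRep k C hC).domain = unitBall (2 * k) from rfl,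
    show (ballRep k C hC).integrand = fun _ => C from rfl, setIntegral_const, measureReal_def,
    volume_unitBall_even, ENNReal.toReal_ofReal (by positivity), smul_eq_mul, mul_comm]

/-! ## The cube Beta representation `[(0,1)^N, Π t_j^{x_j−1}(1−t_j)^{y_j−1}]` and its value `Π B(x_j,y_j)` -/

/-- The open unit cube `(0,1)^N` in the crux's spelling. [folklore] -/
def cubeDom (N : ℕ) : Set (Fin N → ℝ) := {t | ∀ j, t j ∈ Ioo (0:ℝ) 1}

/-- The cube is the product set `Π (0,1)`. [folklore] -/
theorem cubeDom_eq_pi (N : ℕ) : cubeDom N = Set.pi univ fun _ => Ioo (0:ℝ) 1 := by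
  ext t; simp [cubeDom]

/-- The Beta product integrand of the crux. [folklore] -/
def cubeFun {N : ℕ} (x y : Fin N → ℚ) : (Fin N → ℝ) → ℝ :=
  fun t => ∏ j, (t j) ^ ((x j : ℝ) - 1) * (1 - t j) ^ ((y j : ℝ) - 1)

/-- The Beta product integrand is an Euler–Mellin integrand: family `(X_j)_j ++ (1 − X_j)_j`,
exponents `(x_j − 1)_j ++ (y_j − 1)_j`, constant `1`. [folklore] -/
theorem cubeFun_eq_mellinIntegrand {N : ℕ} (x y : Fin N → ℚ) (t : Fin N → ℝ) :
    cubeFun x y t =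
      mellinIntegrand (Fin.append (fun j => (MvPolynomial.X j : MvPolynomial (Fin N) ℚ))
          (fun j => 1 - MvPolynomial.X j))
        (Fin.append (fun j => x j - 1) (fun j => y j - 1)) 1 t := by
  simp only [cubeFun, mellinIntegrand, Rat.cast_one, one_mul, Fin.prod_univ_add, Fin.append_left,
    Fin.append_right, MvPolynomial.aeval_X, map_sub, map_one, Rat.cast_sub, Rat.cast_one,
    ← Finset.prod_mul_distrib]

/-- **The cube Beta representation** `cubeRep x y = [(0,1)^N, Π_j t_j^{x_j−1}(1−t_j)^{y_j−1}]` for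
positive rational exponents (the crux's `r`, canonically). [cite: KontsevichZagier2001, §1.1] -/
def cubeRep {N : ℕ} (x y : Fin N → ℚ) (hpos : ∀ j, 0 < x j ∧ 0 < y j) : IntegralRep N where
  domain := cubeDom N
  integrand := cubeFun x y
  isSemialgebraic_domain := isSemialgebraic_box N
  isSemialgebraicFunOn_integrand := by
    refine (isSemialgebraicFunOn_mellinIntegrand (isSemialgebraic_box N) _ _ 1
      (fun t ht k => ?_)).congr fun t _ => (cubeFun_eq_mellinIntegrand x y t).symm
    refine Fin.addCases (fun i => ?_) (fun i => ?_) k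
    · rw [Fin.append_left]
      simpa using (ht i).1
    · rw [Fin.append_right]
      simpa [sub_pos] using (ht i).2
  integrableOn := by
    have h : ∀ j : Fin N, Integrable (fun s : ℝ => s ^ ((x j : ℝ) - 1) * (1 - s) ^ ((y j : ℝ) - 1))
        ((volume : Measure ℝ).restrict (Ioo 0 1)) := fun j =>
      (integrableOn_betaIntegrand_and_integral_eq (by exact_mod_cast (hpos j).1)
        (by exact_mod_cast (hpos j).2)).1
    have hprod := Integrable.fintype_prod (ι := Fin N) (μ := fun _ => (volume : Measure ℝ).restrict (Ioo 0 1)) h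
    rw [IntegrableOn, show cubeDom N = Set.pi univ fun _ => Ioo (0:ℝ) 1 from cubeDom_eq_pi N, volume_pi,
      Measure.restrict_pi_pi]
    exact hprod

/-- **Value of the cube representation**: `value (cubeRep x y) = Π_j B(x_j, y_j)` (Fubini over the
product set and Mathlib's Beta integral). [folklore] -/
theorem cubeRep_value {N : ℕ} (x y : Fin N → ℚ) (hpos : ∀ j, 0 < x j ∧ 0 < y j) :
    (cubeRep x y hpos).value = ∏ j, ProbabilityTheory.beta (x j) (y j) := by
  rw [IntegralRep.value, show (cubeRep x y hpos).domain = cubeDom N from rfl,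
    show (cubeRep x y hpos).integrand = cubeFun x y from rfl, cubeDom_eq_pi, volume_pi,
    Measure.restrict_pi_pi]
  unfold cubeFun
  rw [integral_fintype_prod_eq_prod (fun j (s : ℝ) => s ^ ((x j : ℝ) - 1) * (1 - s) ^ ((y j : ℝ) - 1))]
  refine Finset.prod_congr rfl fun j _ => ?_
  exact (integrableOn_betaIntegrand_and_integral_eq (by exact_mod_cast (hpos j).1)
    (by exact_mod_cast (hpos j).2)).2

/-- A representation pinned as the crux's cube representation IS `cubeRep` up to congruence
(same domain, integrands agree on it). [folklore] -/
theorem equivalent_cubeRep_of_isCubeBetaRep {N : ℕ} {x y : Fin N → ℚ} (hpos : ∀ j, 0 < x j ∧ 0 < y j)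
    {r : IntegralRep N} (hr : IsCubeBetaRep x y r) : Equivalent r (cubeRep x y hpos) :=
  of_sub_of_mem_relations_of_eqOn (by rw [hr.1]; rfl) fun t ht => by rw [hr.2 ht]; rfl

/-- **Value of a pinned cube representation**: `value r = Π_j B(x_j, y_j)` (by soundness from the
congruence with `cubeRep`). [folklore] -/
theorem value_of_isCubeBetaRep {N : ℕ} {x y : Fin N → ℚ} (hpos : ∀ j, 0 < x j ∧ 0 < y j)
    {r : IntegralRep N} (hr : IsCubeBetaRep x y r) :
    r.value = ∏ j, ProbabilityTheory.beta (x j) (y j) := by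
  rw [Equivalent.value_eq_holds (equivalent_cubeRep_of_isCubeBetaRep hpos hr), cubeRep_value]

/-! ## The ball × cube representation and its value `c · π^k · Π B(x'_l, y'_l)` -/

/-- `c · k!` is algebraic when `c` is. [folklore] -/
theorem isAlgebraic_mul_factorial {c : ℝ} (hc : IsAlgebraic ℚ c) (k : ℕ) :
    IsAlgebraic ℚ (c * (k.factorial : ℝ)) :=
  hc.mul (isAlgebraic_nat _)

/-- **The canonical ball × cube representation** `[B^{2k}, c·k!] × cubeRep x' y'` (the crux's `r'`,
canonically, via `KZ.IntegralRep.prod`). [cite: KontsevichZagier2001, §4.1] -/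
def ballCubeRep {N' : ℕ} (k : ℕ) (x' y' : Fin N' → ℚ) (c : ℝ) (hc : IsAlgebraic ℚ c)
    (hpos : ∀ l, 0 < x' l ∧ 0 < y' l) : IntegralRep (2 * k + N') :=
  (ballRep k (c * (k.factorial : ℝ)) (isAlgebraic_mul_factorial hc k)).prod (cubeRep x' y' hpos)

/-- **Value of the canonical ball × cube representation**: `c · π^k · Π_l B(x'_l, y'_l)`
(`value_prod` = Fubini, the ball volume `π^k/k!` cancels the `k!`). [folklore] -/
theorem ballCubeRep_value {N' : ℕ} (k : ℕ) (x' y' : Fin N' → ℚ) (c : ℝ) (hc : IsAlgebraic ℚ c)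
    (hpos : ∀ l, 0 < x' l ∧ 0 < y' l) :
    (ballCubeRep k x' y' c hc hpos).value = c * Real.pi ^ k * ∏ l, ProbabilityTheory.beta (x' l) (y' l) := by
  rw [ballCubeRep, IntegralRep.value_prod, ballRep_value, cubeRep_value]
  have hk : (k.factorial : ℝ) ≠ 0 := by exact_mod_cast (Nat.factorial_pos k).ne'
  field_simp

/-- A representation pinned as the crux's `[unit 2k-ball × (0,1)^{N'}, c · k! · Π]` IS `ballCubeRep`
up to congruence (its domain is literally `prodDomain`, its integrand agrees with `prodFun` there).
[folklore] -/
theorem equivalent_ballCubeRep_of_isBallCubeRep {N' k : ℕ} {x' y' : Fin N' → ℚ} {c : ℝ}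
    (hpos : ∀ l, 0 < x' l ∧ 0 < y' l) {r' : IntegralRep (2 * k + N')} (hr' : IsBallCubeRep k x' y' c r') :
    Equivalent r' (ballCubeRep k x' y' c (isAlgebraic_of_isBallCubeRep hr') hpos) := by
  refine of_sub_of_mem_relations_of_eqOn ?_ fun z hz => ?_
  · rw [hr'.1]
    ext z
    simp [ballCubeRep, IntegralRep.prod_domain, IntegralRep.mem_prodDomain, ballRep, cubeRep, unitBall,
      cubeDom]
  · rw [hr'.2 hz, ballCubeRep, IntegralRep.prod_integrand_eq]
    simp [IntegralRep.prodFun, ballRep, cubeRep, cubeFun, mul_assoc]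

/-- **Value of a pinned ball × cube representation**: `value r' = c · π^k · Π_l B(x'_l, y'_l)`. [folklore] -/
theorem value_of_isBallCubeRep {N' k : ℕ} {x' y' : Fin N' → ℚ} {c : ℝ} (hpos : ∀ l, 0 < x' l ∧ 0 < y' l)
    {r' : IntegralRep (2 * k + N')} (hr' : IsBallCubeRep k x' y' c r') :
    r'.value = c * Real.pi ^ k * ∏ l, ProbabilityTheory.beta (x' l) (y' l) := by
  rw [Equivalent.value_eq_holds (equivalent_ballCubeRep_of_isBallCubeRep hpos hr'), ballCubeRep_value]

/-! ## The canonical form of the crux and the exact non-vacuity criterion -/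

/-- Admissible data have positive exponents. [folklore] -/
theorem Admissible.pos {N : ℕ} {x y : Fin N → ℚ} (h : Admissible x y) : ∀ j, 0 < x j ∧ 0 < y j :=
  fun j => ⟨(h j).1, (h j).2.1⟩

/-- THE DELIGNE IDENTITY of the data `(k, x, y, x', y', c)`: `Π_j B(x_j, y_j) = c · π^k · Π_l B(x'_l, y'_l)`
— the real-number identity to which the crux's hypothesis `value r = value r'` is equivalent
(`valueEq_iff_deligneIdentity`); for Hodge-type data it holds with the algebraic Deligne–Koblitz–Ogus
constant (Deligne 1982, Thm 7.18; a predicate on the data under analysis, not a citable proposition). -/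
def DeligneIdentity {N N' : ℕ} (k : ℕ) (x y : Fin N → ℚ) (x' y' : Fin N' → ℚ) (c : ℝ) : Prop :=
  ∏ j, ProbabilityTheory.beta (x j) (y j) = c * Real.pi ^ k * ∏ l, ProbabilityTheory.beta (x' l) (y' l)

/-- `cubeRep` is pinned as the crux's cube representation. [folklore] -/
theorem isCubeBetaRep_cubeRep {N : ℕ} (x y : Fin N → ℚ) (hpos : ∀ j, 0 < x j ∧ 0 < y j) :
    IsCubeBetaRep x y (cubeRep x y hpos) :=
  ⟨rfl, fun _ _ => rfl⟩

/-- `ballCubeRep` is pinned as the crux's ball × cube representation. [folklore] -/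
theorem isBallCubeRep_ballCubeRep {N' : ℕ} (k : ℕ) (x' y' : Fin N' → ℚ) (c : ℝ) (hc : IsAlgebraic ℚ c)
    (hpos : ∀ l, 0 < x' l ∧ 0 < y' l) : IsBallCubeRep k x' y' c (ballCubeRep k x' y' c hc hpos) := by
  refine ⟨?_, fun z hz => ?_⟩
  · ext z
    simp [ballCubeRep, IntegralRep.prod_domain, IntegralRep.mem_prodDomain, ballRep, cubeRep, unitBall,
      cubeDom]
  · rw [ballCubeRep, IntegralRep.prod_integrand_eq]
    simp [IntegralRep.prodFun, ballRep, cubeRep, cubeFun, mul_assoc]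

/-- **Value equality ⇔ the Deligne identity**, for pinned representations. [folklore] -/
theorem valueEq_iff_deligneIdentity {N N' k : ℕ} {x y : Fin N → ℚ} {x' y' : Fin N' → ℚ} {c : ℝ}
    (hx : ∀ j, 0 < x j ∧ 0 < y j) (hx' : ∀ l, 0 < x' l ∧ 0 < y' l)
    {r : IntegralRep N} {r' : IntegralRep (2 * k + N')} (hr : IsCubeBetaRep x y r)
    (hr' : IsBallCubeRep k x' y' c r') : r.value = r'.value ↔ DeligneIdentity k x y x' y' c := by
  rw [value_of_isCubeBetaRep hx hr, value_of_isBallCubeRep hx' hr', DeligneIdentity]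

/-- **EXACT NON-VACUITY CRITERION.** For positive exponent data, a real `c` and `k`, representations
`r`, `r'` pinned as in the crux WITH EQUAL VALUES exist if and only if `c` is algebraic and the
Deligne identity `Π B(x,y) = c·π^k·Π B(x',y')` holds. (So each instance of the crux is either vacuous —
wrong `c` — or says exactly `cubeRep x y ∼ ballCubeRep k x' y' c`.) [folklore] -/
theorem exists_pinned_valueEq_iff {N N' : ℕ} (k : ℕ) {x y : Fin N → ℚ} {x' y' : Fin N' → ℚ}
    (hx : ∀ j, 0 < x j ∧ 0 < y j) (hx' : ∀ l, 0 < x' l ∧ 0 < y' l) (c : ℝ) :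
    (∃ (r : IntegralRep N) (r' : IntegralRep (2 * k + N')),
        IsCubeBetaRep x y r ∧ IsBallCubeRep k x' y' c r' ∧ r.value = r'.value) ↔
      IsAlgebraic ℚ c ∧ DeligneIdentity k x y x' y' c := by
  constructor
  · rintro ⟨r, r', hr, hr', hv⟩
    exact ⟨isAlgebraic_of_isBallCubeRep hr', (valueEq_iff_deligneIdentity hx hx' hr hr').mp hv⟩
  · rintro ⟨hc, hD⟩
    exact ⟨cubeRep x y hx, ballCubeRep k x' y' c hc hx', isCubeBetaRep_cubeRep x y hx,
      isBallCubeRep_ballCubeRep k x' y' c hc hx',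
      (valueEq_iff_deligneIdentity hx hx' (isCubeBetaRep_cubeRep x y hx)
        (isBallCubeRep_ballCubeRep k x' y' c hc hx')).mpr hD⟩

/-- **CANONICAL FORM OF THE CRUX.** `GammaHodgeSector` is equivalent to: for all admissible Hodge-type
data, every algebraic `c` satisfying the Deligne identity, `cubeRep x y ∼ ballCubeRep k x' y' c` — ONE
pair of explicit representations per datum (the quantifiers over `r`, `r'` and the value hypothesis
collapse by congruence, `KZ.of_sub_of_mem_relations_of_eqOn`, and the value formulas). [folklore] -/
theorem gammaHodgeSector_iff_canonical :
    GammaHodgeSector ↔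
      ∀ (N N' k : ℕ) (x y : Fin N → ℚ) (x' y' : Fin N' → ℚ) (c : ℝ)
        (hx : Admissible x y) (hx' : Admissible x' y'), HodgeCondition N N' k x y x' y' →
        ∀ hc : IsAlgebraic ℚ c, DeligneIdentity k x y x' y' c →
          Equivalent (cubeRep x y hx.pos) (ballCubeRep k x' y' c hc hx'.pos) := by
  rw [gammaHodgeSector_iff]
  constructor
  · intro h N N' k x y x' y' c hx hx' hH hc hD
    exact h N N' k x y x' y' c hx hx' hH hc _ _ (isCubeBetaRep_cubeRep x y hx.pos)
      (isBallCubeRep_ballCubeRep k x' y' c hc hx'.pos)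
      ((valueEq_iff_deligneIdentity hx.pos hx'.pos (isCubeBetaRep_cubeRep x y hx.pos)
        (isBallCubeRep_ballCubeRep k x' y' c hc hx'.pos)).mpr hD)
  · intro h N N' k x y x' y' c hx hx' hH hc r r' hr hr' hv
    have hD : DeligneIdentity k x y x' y' c := (valueEq_iff_deligneIdentity hx.pos hx'.pos hr hr').mp hv
    have h1 := equivalent_cubeRep_of_isCubeBetaRep hx.pos hr
    have h2 := equivalent_ballCubeRep_of_isBallCubeRep hx'.pos hr'
    exact (h1.trans (h N N' k x y x' y' c hx hx' hH hc hD)).trans h2.symm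

/-- The canonical `r'` factors: `ballCubeRep = [B^{2k}, c·k!] × cubeRep x' y'`, so by the two-sided
ideal property every instance reads `cubeRep x y ∼ [B^{2k}, c·k!] × cubeRep x' y'` — the "ball–disc"
normalisation any line must perform is confined to the factor `[B^{2k}, c·k!]` (value `c·π^k`).
[folklore] -/
theorem ballCubeRep_eq_prod {N' : ℕ} (k : ℕ) (x' y' : Fin N' → ℚ) (c : ℝ) (hc : IsAlgebraic ℚ c)
    (hpos : ∀ l, 0 < x' l ∧ 0 < y' l) :
    KZ.of (ballCubeRep k x' y' c hc hpos) =
      KZ.of (ballRep k (c * (k.factorial : ℝ)) (isAlgebraic_mul_factorial hc k)) * KZ.of (cubeRep x' y' hpos) := by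
  rw [of_mul_of]; rfl

end Summit.KontsevichZagierPeriods.GammaHodgeSectorNegative
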